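import Literature.Geometry.Lorentzian.SpacelikeBoundaryPointExistence
import Literature.Geometry.Lorentzian.CorrespondingBoundaryTendsto
import HarnessLib

/-!
# Existence of a "spacelike" corresponding boundary point (Sbierski 2016, Lemma 15), pure form

J. Sbierski, Ann. Henri Poincaré 17 (2016) 301–329 = arXiv:1309.7591v3, §3.2, Lemma 15: *if the
set `C` of boundary points of the common development `U` having a corresponding boundary point
meets `J⁺(ι(M̄))`, then some `p ∈ C` satisfies `J⁻(p) ∩ ∂U ∩ J⁺(ι(M̄)) = {p}`.*

`SpacelikeBoundaryPointExistence.lean` proves this for an abstract `C ⊆ ∂U ∩ I⁺(S)` which is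
open in `∂U ∩ I⁺(S)` and closed under limits of its points below each of its points. Here, in
the pure two-manifold setting of `CorrespondingBoundaryTendsto.lean` (`M₁ ⊇ U ⊇ S₁`,
`M₂ ⊇ W ⊇ S₂`, maps `ψ`, `φ` inverse to each other between `U` and `W`, transporting timelike
segments; global-hyperbolicity consequences displayed), the second property is established for
the concrete `C = {x ∈ ∂U ∩ I⁺(S₁) | x has a corresponding point}`:

* `causalFuture_of_corresponding_of_causalFuture` — **corresponding points are ordered like the
  boundary points**: if `(x, x')`, `(y, y')` correspond, `x ∈ ∂U ∩ I⁺(S₁)`, and `x ≤ y`, then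
  `x' ≤ y'` (a timelike curve `α` of `U` approaching `x` has `ψ ∘ α → x'` by Prop. 13 (ii),
  `tendsto_of_corresponding_future`, while `ψ (α t) ≤ y'` by the first step of Prop. 13,
  `mem_causalFuture_glue_of_corresponding`; `≤` is closed);
* `exists_corresponding_of_tendsto` — **closedness below a point**: if `x_j → x₀` with
  `(x_j, x'_j)` corresponding, `x_j ∈ ∂U ∩ I⁺(S₁) ∩ J⁻(m)` and `(m, m')` corresponding, then the
  `x'_j` lie in the compact set `J⁻(m') ∩ J⁺(S₂)`, sub-converge to some `x₀'`, and `(x₀, x₀')`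
  correspond;
* `exists_spacelikeCorrespondingPoint` — **Lemma 15**: given the openness of `C` (Lemma 14,
  supplied as a hypothesis at this generality) and one corresponding pair `(p₀, p₀')` with
  `p₀ ∈ ∂U ∩ I⁺(S₁)`, there is a corresponding pair `(p, p')`, `p ∈ ∂U ∩ I⁺(S₁)`, with
  `J⁻(p) ∩ ∂U ∩ J⁺(S₁) = {p}`.

Everything is proved; no definitions, no named facts (D-0026). The printed proof descends a null
geodesic of `∂U` from a point of `C` and uses broken null geodesics; the tree's proof takes a
causally minimal point of the compact set `C ∩ J⁻(p₀)` instead (see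
`SpacelikeBoundaryPointExistence.lean`).

## References

* J. Sbierski, Ann. Henri Poincaré 17 (2016) 301–329 = arXiv:1309.7591v3, §3.2, Prop. 13 and
  Lemma 15 (arXiv numbering). [Sbierski2016AHP]
* B. O'Neill, *Semi-Riemannian geometry with applications to relativity*, Academic Press 1983,
  Ch. 14, Cor. 14.1, Lemma 14.22, Prop. 6.6.6 of Hawking–Ellis as Lemma 14.40.
  [ONeillSemiRiemannian1983]
-/

noncomputable section

open Set Filter Function TopologicalSpace Topology
open scoped Manifold ContDiff Topology

namespace Literature.Geometry.Lorentzian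

namespace LorentzianMetric

section Core

variable {E₁ : Type*} [NormedAddCommGroup E₁] [NormedSpace ℝ E₁] {H₁ : Type*} [TopologicalSpace H₁]
  {I₁ : ModelWithCorners ℝ E₁ H₁} {n₁ : ℕ∞ω} {M₁ : Type*} [TopologicalSpace M₁] [ChartedSpace H₁ M₁]
  [IsManifold I₁ ∞ M₁] [T2Space M₁] [SecondCountableTopology M₁] [BoundarylessManifold I₁ M₁]
  [FiniteDimensional ℝ E₁] {g₁ : LorentzianMetric I₁ n₁ M₁} {τ₁ : TimeOrientation g₁}
  {E₂ : Type*} [NormedAddCommGroup E₂] [NormedSpace ℝ E₂] {H₂ : Type*} [TopologicalSpace H₂]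
  {I₂ : ModelWithCorners ℝ E₂ H₂} {n₂ : ℕ∞ω} {M₂ : Type*} [TopologicalSpace M₂] [ChartedSpace H₂ M₂]
  [IsManifold I₂ ∞ M₂] [T2Space M₂] [SecondCountableTopology M₂] [BoundarylessManifold I₂ M₂]
  [FiniteDimensional ℝ E₂] {g₂ : LorentzianMetric I₂ n₂ M₂} {τ₂ : TimeOrientation g₂}

/-- **Corresponding points are ordered like the boundary points.** In the setting of
`tendsto_of_corresponding_future`, let `(x, x')` and `(y, y')` satisfy the neighbourhood
condition of corresponding boundary points, `x ∈ ∂U ∩ I⁺(S₁)`, `x' ∈ I⁺(S₂)`, and `x ≤ y`. Then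
`x' ≤ y'`: along a future timelike curve `α` of `U` from a point `r₁ ≪ x` of `U` to `x`
(`exists_mem_opens_ll_ll`) one has `ψ (α t) → x'` (Prop. 13 (ii)) and `ψ (α t) ≤ y'`
(`α t ≪ x ≤ y`, `mem_causalFuture_glue_of_corresponding`), and `≤` is closed in `M₂`.
Sbierski 2016, §3.2, proof of Lemma 15 ("we then claim that `γ'(t_∞)` and `γ(t_∞)` are
corresponding boundary points"). [cite: Sbierski2016AHP, §3.2, Prop. 13 and proof of Lemma 15 (arXiv numbering)] -/
theorem causalFuture_of_corresponding_of_causalFuture (hn₁ : 2 ≤ n₁) (hn₂ : 2 ≤ n₂)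
    (hres₁ : PseudoRiemannianMetric.contMDiff_restrict (I := I₁) (n := n₁) (M := M₁))
    (hτ₁ : τ₁.contMDiff_restrict) {S₁ : Set M₁} (hS₁ : g₁.IsCauchyHypersurface τ₁ S₁)
    {U : Opens M₁}
    (hU : (g₁.restrict hres₁ U).IsCauchyHypersurface (τ₁.restrict hres₁ hτ₁ U) (Subtype.val ⁻¹' S₁))
    (hres₂ : PseudoRiemannianMetric.contMDiff_restrict (I := I₂) (n := n₂) (M := M₂))
    (hτ₂ : τ₂.contMDiff_restrict) {S₂ : Set M₂} (hS₂ : g₂.IsCauchyHypersurface τ₂ S₂) {W : Opens M₂}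
    (hW : (g₂.restrict hres₂ W).IsCauchyHypersurface (τ₂.restrict hres₂ hτ₂ W) (Subtype.val ⁻¹' S₂))
    {ψ : M₁ → M₂} {φ : M₂ → M₁} (hψW : MapsTo ψ U W) (hφU : MapsTo φ W U)
    (hφψ : ∀ y ∈ (U : Set M₁), φ (ψ y) = y) (hψφ : ∀ z ∈ (W : Set M₂), ψ (φ z) = z)
    (hpush : ∀ ⦃γ : ℝ → M₁⦄ ⦃a b : ℝ⦄, a < b → g₁.IsFutureTimelikeCurveOn τ₁ γ (Icc a b) →
      (∀ t ∈ Icc a b, γ t ∈ U) → ψ (γ b) ∈ g₂.chronologicalFuture τ₂ {ψ (γ a)})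
    (hpushφ : ∀ ⦃γ : ℝ → M₂⦄ ⦃a b : ℝ⦄, a < b → g₂.IsFutureTimelikeCurveOn τ₂ γ (Icc a b) →
      (∀ t ∈ Icc a b, γ t ∈ W) → φ (γ b) ∈ g₁.chronologicalFuture τ₁ {φ (γ a)})
    (hrel₁ : ∀ {xs ys : ℕ → M₁} {x y : M₁}, Tendsto xs atTop (𝓝 x) → Tendsto ys atTop (𝓝 y) →
      (∀ j, ys j ∈ g₁.causalFuture τ₁ {xs j}) → y ∈ g₁.causalFuture τ₁ {x})
    (hrel₂ : ∀ {xs ys : ℕ → M₂} {x y : M₂}, Tendsto xs atTop (𝓝 x) → Tendsto ys atTop (𝓝 y) →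
      (∀ j, ys j ∈ g₂.causalFuture τ₂ {xs j}) → y ∈ g₂.causalFuture τ₂ {x})
    (hSC₂ : g₂.IsStronglyCausal τ₂)
    {x : M₁} (hx : x ∈ frontier (U : Set M₁)) (hxI : x ∈ g₁.chronologicalFuture τ₁ S₁) {x' : M₂}
    (hx'I : x' ∈ g₂.chronologicalFuture τ₂ S₂)
    (hcorrx : ∀ V ∈ 𝓝 x, ∀ V' ∈ 𝓝 x', ∃ z ∈ (U : Set M₁), z ∈ V ∧ ψ z ∈ V')
    {y : M₁} {y' : M₂}
    (hcorry : ∀ V ∈ 𝓝 y, ∀ V' ∈ 𝓝 y', ∃ z ∈ (U : Set M₁), z ∈ V ∧ ψ z ∈ V')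
    (hxy : y ∈ g₁.causalFuture τ₁ {x}) : y' ∈ g₂.causalFuture τ₂ {x'} := by
  have hn1 : (1 : ℕ∞ω) ≤ n₁ := le_trans one_le_two hn₁
  have hxcl : x ∈ closure (U : Set M₁) := frontier_subset_closure hx
  -- a timelike curve `α` of `U` from `r₁ ≪ x` to `x`
  obtain ⟨-, r₁, -, hr₁U, -, -, hxr₁⟩ := exists_mem_opens_ll_ll hn₁ hres₁ hτ₁ hS₁ hU hx hxI
  obtain ⟨x₀, hx₀, α, a, b, hab, hα, hαa, hαb⟩ := hxr₁
  rw [mem_singleton_iff] at hx₀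
  subst hx₀
  have hαU : ∀ t ∈ Ico a b, α t ∈ U := by
    intro t ht
    rcases eq_or_lt_of_le ht.1 with hat | hat
    · rw [← hat, hαa]; exact hr₁U
    · refine hS₁.chronologicalFuture_inter_chronologicalPast_subset_opens hn₁ _ _ hU
        (q := α a) (p := α b) (by rw [hαa]; exact hr₁U) (by rw [hαb]; exact hxcl) ⟨?_, ?_⟩
      · exact ⟨α a, rfl, α, a, t, hat, hα.mono (Icc_subset_Icc_right ht.2.le), rfl, rfl⟩
      · exact mem_chronologicalPast_of_mem_chronologicalFuture
          ⟨α t, rfl, α, t, b, ht.2, hα.mono (Icc_subset_Icc_left ht.1), rfl, rfl⟩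
  have hαlim : Tendsto α (𝓝[<] b) (𝓝 x) := by
    rw [← hαb]
    exact ((hα b (right_mem_Icc.2 hab.le)).1.continuousAt.continuousWithinAt).tendsto
  have hψα : Tendsto (ψ ∘ α) (𝓝[<] b) (𝓝 x') :=
    tendsto_of_corresponding_future hn₁ hn₂ hres₁ hτ₁ hS₁ hU hres₂ hτ₂ hS₂ hW hψW hφU hφψ hψφ hpush
      hpushφ hrel₁ hrel₂ hSC₂ hx'I hcorrx hab (hα.mono Ico_subset_Icc_self) hαU hαlim
  -- `ψ (α t) ≤ y'` for `t < b`
  have hle : ∀ t ∈ Ico a b, y' ∈ g₂.causalFuture τ₂ {ψ (α t)} := by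
    intro t ht
    have h1 : x ∈ g₁.chronologicalFuture τ₁ {α t} := by
      rw [← hαb]
      exact ⟨α t, rfl, α, t, b, ht.2, hα.mono (Icc_subset_Icc_left ht.1), rfl, rfl⟩
    have h2 : y ∈ g₁.chronologicalFuture τ₁ {α t} :=
      mem_chronologicalFuture_of_mem_chronologicalFuture_of_mem_causalFuture hn1 h1 hxy
    exact mem_causalFuture_glue_of_corresponding hn₁ hres₁ hτ₁ hS₁ hU hpush hrel₂ hcorry (hαU t ht) h2
  -- a sequence `t_j ↑ b` and the closedness of `≤`
  set s : ℕ → ℝ := fun j ↦ b - (b - a) / ((j : ℝ) + 2) with hs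
  have hsI : ∀ j, s j ∈ Ico a b := by
    intro j
    have hj : (2 : ℝ) ≤ (j : ℝ) + 2 := by
      have : (0 : ℝ) ≤ j := Nat.cast_nonneg j
      linarith
    have hpos : 0 < (j : ℝ) + 2 := by linarith
    have hba : 0 < b - a := sub_pos.2 hab
    constructor
    · show a ≤ b - (b - a) / ((j : ℝ) + 2)
      have h1 : (b - a) / ((j : ℝ) + 2) ≤ (b - a) / 2 :=
        div_le_div_of_nonneg_left hba.le (by norm_num) hj
      linarith
    · show b - (b - a) / ((j : ℝ) + 2) < b
      have h1 : 0 < (b - a) / ((j : ℝ) + 2) := div_pos hba hpos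
      linarith
  have hslim : Tendsto s atTop (𝓝[<] b) := by
    refine tendsto_nhdsWithin_iff.2 ⟨?_, Eventually.of_forall fun j ↦ (hsI j).2⟩
    have h1 : Tendsto (fun j : ℕ ↦ (b - a) / ((j : ℝ) + 2)) atTop (𝓝 0) := by
      have h2 : Tendsto (fun j : ℕ ↦ (j : ℝ) + 2) atTop atTop :=
        tendsto_natCast_atTop_atTop.atTop_add tendsto_const_nhds
      exact h2.const_div_atTop (b - a)
    have h3 : Tendsto (fun j : ℕ ↦ b - (b - a) / ((j : ℝ) + 2)) atTop (𝓝 (b - 0)) :=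
      tendsto_const_nhds.sub h1
    rwa [sub_zero] at h3
  exact hrel₂ (hψα.comp hslim) tendsto_const_nhds fun j ↦ hle (s j) (hsI j)

/-- **Closedness of the set of corresponding boundary points below one of its points.** If
`(m, m')` correspond, `x_j ∈ ∂U ∩ I⁺(S₁) ∩ J⁻(m)` have corresponding points `x'_j`, and
`x_j → x₀`, then `x₀` has a corresponding point: the `x'_j` lie in `J⁻(m') ∩ J⁺(S₂)`
(`causalFuture_of_corresponding_of_causalFuture`; `x'_j ∈ I⁺(S₂)` by
`mem_chronologicalFuture_glue_of_corresponding`), a compact set, so a subsequence converges to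
some `x₀'`, and the neighbourhood condition passes to the limit. Sbierski 2016, §3.2, proof of
Lemma 15 (closedness of `J`). [cite: Sbierski2016AHP, §3.2, proof of Lemma 15 (arXiv numbering)] -/
theorem exists_corresponding_of_tendsto (hn₁ : 2 ≤ n₁) (hn₂ : 2 ≤ n₂)
    (hres₁ : PseudoRiemannianMetric.contMDiff_restrict (I := I₁) (n := n₁) (M := M₁))
    (hτ₁ : τ₁.contMDiff_restrict) {S₁ : Set M₁} (hS₁ : g₁.IsCauchyHypersurface τ₁ S₁)
    {U : Opens M₁} (hS₁U : S₁ ⊆ U)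
    (hU : (g₁.restrict hres₁ U).IsCauchyHypersurface (τ₁.restrict hres₁ hτ₁ U) (Subtype.val ⁻¹' S₁))
    (hres₂ : PseudoRiemannianMetric.contMDiff_restrict (I := I₂) (n := n₂) (M := M₂))
    (hτ₂ : τ₂.contMDiff_restrict) {S₂ : Set M₂} (hS₂ : g₂.IsCauchyHypersurface τ₂ S₂) {W : Opens M₂}
    (hW : (g₂.restrict hres₂ W).IsCauchyHypersurface (τ₂.restrict hres₂ hτ₂ W) (Subtype.val ⁻¹' S₂))
    {ψ : M₁ → M₂} {φ : M₂ → M₁} (hψW : MapsTo ψ U W) (hφU : MapsTo φ W U)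
    (hφψ : ∀ y ∈ (U : Set M₁), φ (ψ y) = y) (hψφ : ∀ z ∈ (W : Set M₂), ψ (φ z) = z)
    (hψS : ψ '' S₁ ⊆ S₂)
    (hpush : ∀ ⦃γ : ℝ → M₁⦄ ⦃a b : ℝ⦄, a < b → g₁.IsFutureTimelikeCurveOn τ₁ γ (Icc a b) →
      (∀ t ∈ Icc a b, γ t ∈ U) → ψ (γ b) ∈ g₂.chronologicalFuture τ₂ {ψ (γ a)})
    (hpushφ : ∀ ⦃γ : ℝ → M₂⦄ ⦃a b : ℝ⦄, a < b → g₂.IsFutureTimelikeCurveOn τ₂ γ (Icc a b) →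
      (∀ t ∈ Icc a b, γ t ∈ W) → φ (γ b) ∈ g₁.chronologicalFuture τ₁ {φ (γ a)})
    (hrel₁ : ∀ {xs ys : ℕ → M₁} {x y : M₁}, Tendsto xs atTop (𝓝 x) → Tendsto ys atTop (𝓝 y) →
      (∀ j, ys j ∈ g₁.causalFuture τ₁ {xs j}) → y ∈ g₁.causalFuture τ₁ {x})
    (hrel₂ : ∀ {xs ys : ℕ → M₂} {x y : M₂}, Tendsto xs atTop (𝓝 x) → Tendsto ys atTop (𝓝 y) →
      (∀ j, ys j ∈ g₂.causalFuture τ₂ {xs j}) → y ∈ g₂.causalFuture τ₂ {x})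
    (hSC₂ : g₂.IsStronglyCausal τ₂)
    (hK₂ : ∀ x' : M₂, IsCompact (g₂.causalPast τ₂ {x'} ∩ g₂.causalFuture τ₂ S₂))
    {m : M₁} {m' : M₂} (hcorrm : ∀ V ∈ 𝓝 m, ∀ V' ∈ 𝓝 m', ∃ z ∈ (U : Set M₁), z ∈ V ∧ ψ z ∈ V')
    {x : ℕ → M₁} (hxfr : ∀ j, x j ∈ frontier (U : Set M₁))
    (hxI : ∀ j, x j ∈ g₁.chronologicalFuture τ₁ S₁)
    (hxC : ∀ j, ∃ x' : M₂, ∀ V ∈ 𝓝 (x j), ∀ V' ∈ 𝓝 x', ∃ z ∈ (U : Set M₁), z ∈ V ∧ ψ z ∈ V')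
    (hxm : ∀ j, x j ∈ g₁.causalPast τ₁ {m}) {x₀ : M₁} (hlim : Tendsto x atTop (𝓝 x₀)) :
    ∃ x₀' : M₂, ∀ V ∈ 𝓝 x₀, ∀ V' ∈ 𝓝 x₀', ∃ z ∈ (U : Set M₁), z ∈ V ∧ ψ z ∈ V' := by
  choose x' hx' using hxC
  -- the `x'_j` lie in the compact set `J⁻(m') ∩ J⁺(S₂)`
  have hx'I : ∀ j, x' j ∈ g₂.chronologicalFuture τ₂ S₂ := by
    intro j
    obtain ⟨r, r₁, hrU, hr₁U, hrI, hrr₁, hpr₁⟩ :=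
      exists_mem_opens_ll_ll hn₁ hres₁ hτ₁ hS₁ hU (hxfr j) (hxI j)
    exact (mem_chronologicalFuture_glue_of_corresponding hn₁ hn₂ hres₁ hτ₁ hS₁ hS₁U hU hS₂ hψS rfl hpush
      hrel₂ (hx' j) hrU hr₁U hrI hrr₁ hpr₁).2.2.1
  have hx'Q : ∀ j, x' j ∈ g₂.causalPast τ₂ {m'} ∩ g₂.causalFuture τ₂ S₂ := fun j ↦
    ⟨mem_causalPast_singleton_iff.2 (causalFuture_of_corresponding_of_causalFuture hn₁ hn₂ hres₁ hτ₁
      hS₁ hU hres₂ hτ₂ hS₂ hW hψW hφU hφψ hψφ hpush hpushφ hrel₁ hrel₂ hSC₂ (hxfr j) (hxI j)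
      (hx'I j) (hx' j) hcorrm (mem_causalPast_singleton_iff.1 (hxm j))),
      chronologicalFuture_subset_causalFuture _ _ _ (hx'I j)⟩
  obtain ⟨x₀', -, σ, hσ, hσlim⟩ := (hK₂ m').tendsto_subseq hx'Q
  refine ⟨x₀', fun V hV V' hV' ↦ ?_⟩
  -- pass the neighbourhood condition to the limit along the subsequence
  have h1 : ∀ᶠ j in atTop, x (σ j) ∈ interior V :=
    (hlim.comp hσ.tendsto_atTop) (isOpen_interior.mem_nhds (mem_interior_iff_mem_nhds.2 hV))
  have h2 : ∀ᶠ j in atTop, x' (σ j) ∈ interior V' :=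
    hσlim (isOpen_interior.mem_nhds (mem_interior_iff_mem_nhds.2 hV'))
  obtain ⟨j, hj, hj'⟩ := (h1.and h2).exists
  obtain ⟨z, hzU, hzV, hzV'⟩ := hx' (σ j) _ (isOpen_interior.mem_nhds hj) _
    (isOpen_interior.mem_nhds hj')
  exact ⟨z, hzU, interior_subset hzV, interior_subset hzV'⟩

/-- **Sbierski's Lemma 15, pure form.** In the setting above (with, in `M₁`, compactness of
`J⁻(x) ∩ J⁺(S₁)`, closedness of `J⁻(x)` and the causality condition), suppose the set `C` of
points of `∂U ∩ I⁺(S₁)` having a corresponding point is open in `∂U` near each of its points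
(Lemma 14, hypothesis `hopen`) and contains `p₀`. Then some `p ∈ C` satisfies
`J⁻(p) ∩ ∂U ∩ J⁺(S₁) = {p}` (`IsCauchyHypersurface.exists_spacelikeBoundaryPoint` with the
closedness property `exists_corresponding_of_tendsto`). [cite: Sbierski2016AHP, §3.2, Lemma 15 (arXiv numbering)] -/
theorem exists_spacelikeCorrespondingPoint (hn₁ : 2 ≤ n₁) (hn₂ : 2 ≤ n₂)
    (hres₁ : PseudoRiemannianMetric.contMDiff_restrict (I := I₁) (n := n₁) (M := M₁))
    (hτ₁ : τ₁.contMDiff_restrict) {S₁ : Set M₁} (hS₁ : g₁.IsCauchyHypersurface τ₁ S₁)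
    {U : Opens M₁} (hS₁U : S₁ ⊆ U)
    (hU : (g₁.restrict hres₁ U).IsCauchyHypersurface (τ₁.restrict hres₁ hτ₁ U) (Subtype.val ⁻¹' S₁))
    (hres₂ : PseudoRiemannianMetric.contMDiff_restrict (I := I₂) (n := n₂) (M := M₂))
    (hτ₂ : τ₂.contMDiff_restrict) {S₂ : Set M₂} (hS₂ : g₂.IsCauchyHypersurface τ₂ S₂) {W : Opens M₂}
    (hW : (g₂.restrict hres₂ W).IsCauchyHypersurface (τ₂.restrict hres₂ hτ₂ W) (Subtype.val ⁻¹' S₂))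
    {ψ : M₁ → M₂} {φ : M₂ → M₁} (hψW : MapsTo ψ U W) (hφU : MapsTo φ W U)
    (hφψ : ∀ y ∈ (U : Set M₁), φ (ψ y) = y) (hψφ : ∀ z ∈ (W : Set M₂), ψ (φ z) = z)
    (hψS : ψ '' S₁ ⊆ S₂)
    (hpush : ∀ ⦃γ : ℝ → M₁⦄ ⦃a b : ℝ⦄, a < b → g₁.IsFutureTimelikeCurveOn τ₁ γ (Icc a b) →
      (∀ t ∈ Icc a b, γ t ∈ U) → ψ (γ b) ∈ g₂.chronologicalFuture τ₂ {ψ (γ a)})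
    (hpushφ : ∀ ⦃γ : ℝ → M₂⦄ ⦃a b : ℝ⦄, a < b → g₂.IsFutureTimelikeCurveOn τ₂ γ (Icc a b) →
      (∀ t ∈ Icc a b, γ t ∈ W) → φ (γ b) ∈ g₁.chronologicalFuture τ₁ {φ (γ a)})
    (hrel₁ : ∀ {xs ys : ℕ → M₁} {x y : M₁}, Tendsto xs atTop (𝓝 x) → Tendsto ys atTop (𝓝 y) →
      (∀ j, ys j ∈ g₁.causalFuture τ₁ {xs j}) → y ∈ g₁.causalFuture τ₁ {x})
    (hrel₂ : ∀ {xs ys : ℕ → M₂} {x y : M₂}, Tendsto xs atTop (𝓝 x) → Tendsto ys atTop (𝓝 y) →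
      (∀ j, ys j ∈ g₂.causalFuture τ₂ {xs j}) → y ∈ g₂.causalFuture τ₂ {x})
    (hSC₂ : g₂.IsStronglyCausal τ₂)
    (hK₁ : ∀ x : M₁, IsCompact (g₁.causalPast τ₁ {x} ∩ g₁.causalFuture τ₁ S₁))
    (hJ₁ : ∀ x : M₁, IsClosed (g₁.causalPast τ₁ {x})) (hcaus₁ : g₁.IsCausallyWellBehaved τ₁)
    (hK₂ : ∀ x' : M₂, IsCompact (g₂.causalPast τ₂ {x'} ∩ g₂.causalFuture τ₂ S₂))
    (hopen : ∀ z ∈ frontier (U : Set M₁), z ∈ g₁.chronologicalFuture τ₁ S₁ → ∀ z' : M₂,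
      (∀ V ∈ 𝓝 z, ∀ V' ∈ 𝓝 z', ∃ y ∈ (U : Set M₁), y ∈ V ∧ ψ y ∈ V') →
      ∃ V ∈ 𝓝 z, ∀ w ∈ V, w ∈ frontier (U : Set M₁) →
        ∃ w' : M₂, ∀ O ∈ 𝓝 w, ∀ O' ∈ 𝓝 w', ∃ y ∈ (U : Set M₁), y ∈ O ∧ ψ y ∈ O')
    {p₀ : M₁} (hp₀ : p₀ ∈ frontier (U : Set M₁)) (hp₀I : p₀ ∈ g₁.chronologicalFuture τ₁ S₁)
    {p₀' : M₂} (hcorr₀ : ∀ V ∈ 𝓝 p₀, ∀ V' ∈ 𝓝 p₀', ∃ y ∈ (U : Set M₁), y ∈ V ∧ ψ y ∈ V') :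
    ∃ p : M₁, p ∈ frontier (U : Set M₁) ∧ p ∈ g₁.chronologicalFuture τ₁ S₁ ∧
      (∃ p' : M₂, ∀ V ∈ 𝓝 p, ∀ V' ∈ 𝓝 p', ∃ y ∈ (U : Set M₁), y ∈ V ∧ ψ y ∈ V') ∧
      ∀ q ∈ g₁.causalPast τ₁ {p} ∩ frontier (U : Set M₁) ∩ g₁.causalFuture τ₁ S₁, q = p := by
  set C : Set M₁ := {z | z ∈ frontier (U : Set M₁) ∧ z ∈ g₁.chronologicalFuture τ₁ S₁ ∧
    ∃ z' : M₂, ∀ V ∈ 𝓝 z, ∀ V' ∈ 𝓝 z', ∃ y ∈ (U : Set M₁), y ∈ V ∧ ψ y ∈ V'} with hC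
  have hopen' : ∀ z ∈ C, ∃ V ∈ 𝓝 z, ∀ w ∈ V, w ∈ frontier (U : Set M₁) →
      w ∈ g₁.chronologicalFuture τ₁ S₁ → w ∈ C := by
    rintro z ⟨hz, hzI, z', hzz'⟩
    obtain ⟨V, hV, hVC⟩ := hopen z hz hzI z' hzz'
    exact ⟨V, hV, fun w hw hwfr hwI ↦ ⟨hwfr, hwI, hVC w hw hwfr⟩⟩
  have hclosed' : ∀ m ∈ C, ∀ (x : ℕ → M₁) (x₀ : M₁), (∀ j, x j ∈ C ∧ x j ∈ g₁.causalPast τ₁ {m}) →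
      Tendsto x atTop (𝓝 x₀) → x₀ ∈ frontier (U : Set M₁) → x₀ ∈ g₁.chronologicalFuture τ₁ S₁ →
      x₀ ∈ C := by
    rintro m ⟨-, -, m', hmm'⟩ x x₀ hx hlim hx₀ hx₀I
    exact ⟨hx₀, hx₀I, exists_corresponding_of_tendsto hn₁ hn₂ hres₁ hτ₁ hS₁ hS₁U hU hres₂ hτ₂ hS₂ hW
      hψW hφU hφψ hψφ hψS hpush hpushφ hrel₁ hrel₂ hSC₂ hK₂ hmm' (fun j ↦ (hx j).1.1)
      (fun j ↦ (hx j).1.2.1) (fun j ↦ (hx j).1.2.2) (fun j ↦ (hx j).2) hlim⟩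
  obtain ⟨p, ⟨hp, hpI, hp'⟩, hsp⟩ := hS₁.exists_spacelikeBoundaryPoint hn₁ hres₁ hτ₁ hS₁U hU hK₁ hJ₁
    hcaus₁ (C := C) (fun z hz ↦ hz.1) (fun z hz ↦ hz.2.1) hopen' hclosed' ⟨hp₀, hp₀I, p₀', hcorr₀⟩
  exact ⟨p, hp, hpI, hp', hsp⟩

end Core

end LorentzianMetric

end Literature.Geometry.Lorentzian

end
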